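import Literature.Analysis.FluidPDE.AxisymPoloidalPart
import Literature.Analysis.FluidPDE.AxisymHouLiVariables
import Literature.Analysis.FluidPDE.AxisymVorticityAlgebra
import Literature.Analysis.FluidPDE.AxisymOmegaThetaEnergy
import HarnessLib

/-!
# The smooth poloidal field `b = v − Φ J` of an axisymmetric field: `curl b = ω^θ e_θ`,
# `div b = div v`, `|b| ≤ 2|v|`

Analysis/FluidPDE support file (theorems only; no definitions, no named facts) on the way to
`Literature.Analysis.FluidPDE.Wei2016_logModulus_regularity`
(`LeiZhang2017AxisymmetricCriteria.lean`). The last step of the a-priori regularity argument of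
Wei 2016, Thm. 1.1 / Lei–Zhang 2017, §3 (arXiv:1505.02628, p. 9: "`∇(vʳe_r + v^ze_z) ∈ L∞L²`
… `v^θ ∈ L∞L⁴`, `b = vʳe_r + v^ze_z ∈ L^∞_tL⁶ ∩ L^∞L²`, … `v ∈ L∞L⁴`, which implies `v` is
regular") estimates the poloidal part `b = vʳe_r + v^ze_z` of the velocity by the `div`–`curl`
system `div b = 0`, `curl b = ω^θ e_θ`. With the smooth Hou–Li variable `Φ = angVelQuot v`
(`v^θ e_θ = Φ J`, `J y = (−y₁, y₀, 0)`), `b y = v y − Φ(y) J y` is smooth across the axis and: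

* `Wei2016.isAxisymmetric_sub_angVelQuot_smul_rotGen`, `Wei2016.hasNoSwirl_sub_angVelQuot_smul_rotGen`
  — `b` is axisymmetric and swirl free (`swirl (ΦJ) = r²Φ = Γ`);
* `Wei2016.norm_curl_sub_angVelQuot_smul_rotGen_sq` — **`|curl b|² = r²Ω²`** (`Ω = angVortQuot v`,
  `ω^θ = rΩ`): by the tree's structure theorem `curl b = f J` for axisymmetric swirl-free fields
  (`curl_eq_hadamardQuotFst_smul_rotGen`) and `⟪curl b, J⟫ = ⟪curl v, J⟫ = swirl ω = r²Ω`
  (`⟪curl (ΦJ), J⟫ = 0`, `inner_curl_smul_rotGen_rotGen`);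
* `Wei2016.divergence_sub_angVelQuot_smul_rotGen` — `div b = div v` (`div J = 0`, `DΦ[J y] = 0`);
* `Wei2016.norm_sub_angVelQuot_smul_rotGen_le` — `|b| ≤ 2|v|` (`r|Φ| ≤ |v|`);
* `Wei2016.norm_angVelQuot_smul_rotGen_pow_four` — `|ΦJ|⁴ = (x₀² + x₁²)²Φ⁴ = (v^θ)⁴`.

## References

* Z. Lei, Q. S. Zhang, arXiv:1505.02628, §3 p. 9 (the poloidal `div`–`curl` step). [LeiZhang2017]
* D. Wei, arXiv:1508.03318, end of the proof of Thm. 1.1. [Wei2016]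
-/

noncomputable section

open Set Function InnerProductSpace
open scoped RealInnerProductSpace ContDiff

namespace Literature.Analysis.FluidPDE

namespace Wei2016

variable {u : EuclideanSpace ℝ (Fin 3) → EuclideanSpace ℝ (Fin 3)}

/-- `R_θ (a − b) = R_θ a − R_θ b`. [folklore] -/
private theorem rotZ_sub' (θ : ℝ) (a b : EuclideanSpace ℝ (Fin 3)) : rotZ θ (a - b) = rotZ θ a - rotZ θ b := by
  ext i
  fin_cases i <;> simp [rotZ] <;> ring

/-- `R_θ (c a) = c R_θ a`. [folklore] -/
private theorem rotZ_smul' (θ c : ℝ) (a : EuclideanSpace ℝ (Fin 3)) : rotZ θ (c • a) = c • rotZ θ a := by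
  ext i
  fin_cases i <;> simp [rotZ] <;> ring

/-- **`b = v − ΦJ` is axisymmetric** for `v ∈ C²` axisymmetric. [folklore] -/
theorem isAxisymmetric_sub_angVelQuot_smul_rotGen (hax : IsAxisymmetric u) (hu : ContDiff ℝ 2 u) :
    IsAxisymmetric (fun y => u y - angVelQuot u y • rotGen y) := by
  intro θ x
  have hΦ := hax.isAxisymmetricScalar_angVelQuot hu θ x
  simp only
  rw [hax θ x, hΦ, rotGen_rotZ, rotZ_sub', rotZ_smul']

/-- **`b = v − ΦJ` is swirl free** (`swirl (ΦJ) = (x₀² + x₁²)Φ = Γ = swirl v`). [folklore] -/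
theorem hasNoSwirl_sub_angVelQuot_smul_rotGen (hax : IsAxisymmetric u) (hu : ContDiff ℝ 2 u) :
    HasNoSwirl (fun y => u y - angVelQuot u y • rotGen y) := by
  intro x
  have h := hax.cylRadius_sq_mul_angVelQuot hu x
  rw [cylRadius_sq] at h
  have hs : swirl u x = x 0 * u x 1 - x 1 * u x 0 := rfl
  show x 0 * (u x - angVelQuot u x • rotGen x) 1 - x 1 * (u x - angVelQuot u x • rotGen x) 0 = 0
  simp only [PiLp.sub_apply, PiLp.smul_apply, smul_eq_mul, rotGen_apply_zero, rotGen_apply_one]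
  nlinarith [h, hs]

/-- **`|curl b|² = (x₀² + x₁²) Ω²`** for `b = v − ΦJ`, `v ∈ C⁴` axisymmetric (`curl b = ω^θ e_θ`,
`ω^θ = rΩ`). [cite: LeiZhang2017, §3 p. 9] -/
theorem norm_curl_sub_angVelQuot_smul_rotGen_sq (hax : IsAxisymmetric u) (hu : ContDiff ℝ 4 u)
    (x : EuclideanSpace ℝ (Fin 3)) :
    ‖curl (fun y => u y - angVelQuot u y • rotGen y) x‖ ^ 2 = (x 0 ^ 2 + x 1 ^ 2) * angVortQuot u x ^ 2 := by
  have hu2 : ContDiff ℝ 2 u := hu.of_le (by norm_num)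
  have hu3 : ContDiff ℝ 3 u := hu.of_le (by norm_num)
  have hud : Differentiable ℝ u := hu.differentiable (by norm_num)
  have hΦ2 : ContDiff ℝ 2 (angVelQuot u) := contDiff_angVelQuot (n := 2) hu
  have hΦd : Differentiable ℝ (angVelQuot u) := hΦ2.differentiable (by norm_num)
  have hJ : ContDiff ℝ 2 (rotGen : EuclideanSpace ℝ (Fin 3) → EuclideanSpace ℝ (Fin 3)) := by
    have : (rotGen : EuclideanSpace ℝ (Fin 3) → EuclideanSpace ℝ (Fin 3)) = ⇑rotGenL := by
      funext v; rfl
    rw [this]; exact rotGenL.contDiff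
  have hw : ContDiff ℝ 2 fun y => angVelQuot u y • rotGen y := hΦ2.smul hJ
  have hb2 : ContDiff ℝ 2 fun y => u y - angVelQuot u y • rotGen y := hu2.sub hw
  -- structure of the curl of an axisymmetric swirl-free field
  have hf := curl_eq_hadamardQuotFst_smul_rotGen (isAxisymmetric_sub_angVelQuot_smul_rotGen hax hu2)
    (hasNoSwirl_sub_angVelQuot_smul_rotGen hax hu2) hb2 x
  set f : ℝ := hadamardQuotFst (fun y => curl (fun y => u y - angVelQuot u y • rotGen y) y 1) x with hfdef
  -- `⟪curl b, J⟫ = ⟪curl v, J⟫ = swirl ω = r² Ω`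
  have hinner : ⟪curl (fun y => u y - angVelQuot u y • rotGen y) x, rotGen x⟫ =
      (x 0 ^ 2 + x 1 ^ 2) * angVortQuot u x := by
    rw [curl_sub (hud x) ((hw.differentiable (by norm_num)) x), inner_sub_left,
      inner_curl_smul_rotGen_rotGen (hΦd x), sub_zero, ← cylRadius_sq, hax.cylRadius_sq_mul_angVortQuot hu3 x,
      real_inner_comm, inner_rotGen_left]
    rfl
  rw [hf] at hinner ⊢
  rw [inner_smul_left, RCLike.conj_to_real, real_inner_self_eq_norm_sq, norm_rotGen_sq] at hinner
  rw [norm_smul_rotGen_sq]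
  -- `f ρ = ρ Ω`  ⇒  `f² ρ = ρ Ω²`
  rcases eq_or_ne (x 0 ^ 2 + x 1 ^ 2) 0 with hρ | hρ
  · rw [hρ]; ring
  · have hfΩ : f = angVortQuot u x := by
      have h' : f * (x 0 ^ 2 + x 1 ^ 2) = angVortQuot u x * (x 0 ^ 2 + x 1 ^ 2) := by linarith [hinner]
      exact mul_right_cancel₀ hρ h'
    rw [hfΩ]; ring

/-- **`div b = div v`** for `b = v − ΦJ`, `v ∈ C³` axisymmetric (`div J = 0` and `DΦ[J y] = 0`,
`Φ` being constant along the rotation orbits). [folklore] -/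
theorem divergence_sub_angVelQuot_smul_rotGen (hax : IsAxisymmetric u) (hu : ContDiff ℝ 3 u)
    (y : EuclideanSpace ℝ (Fin 3)) :
    VectorCalculus.divergence (fun x => u x - angVelQuot u x • rotGen x) y = VectorCalculus.divergence u y := by
  have hu2 : ContDiff ℝ 2 u := hu.of_le (by norm_num)
  have hud : Differentiable ℝ u := hu.differentiable (by norm_num)
  have hΦ1 : ContDiff ℝ 1 (angVelQuot u) := contDiff_angVelQuot (n := 1) (by exact_mod_cast hu)
  have hg : DifferentiableAt ℝ (angVelQuot u) y := (hΦ1.differentiable one_ne_zero) y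
  have hJd : DifferentiableAt ℝ (rotGen : EuclideanSpace ℝ (Fin 3) → EuclideanSpace ℝ (Fin 3)) y :=
    (hasFDerivAt_rotGen y).differentiableAt
  have hw : DifferentiableAt ℝ (fun x => angVelQuot u x • rotGen x) y := hg.smul hJd
  have horbit : ∀ θ : ℝ, angVelQuot u (rotZ θ y) = angVelQuot u y := fun θ =>
    hax.isAxisymmetricScalar_angVelQuot hu2 θ y
  have hzero : fderiv ℝ (angVelQuot u) y (rotGen y) = 0 :=
    fderiv_apply_rotGen_eq_zero_of_forall_rotZ horbit hg
  have hdivJ : VectorCalculus.divergence rotGen y = 0 := by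
    rw [divergence_eq_sum_inner_fderiv (EuclideanSpace.basisFun (Fin 3) ℝ),
      (hasFDerivAt_rotGen y).fderiv]
    simp [Fin.sum_univ_three, rotGen_single_zero, rotGen_single_one, rotGen_single_two,
      EuclideanSpace.inner_single_left]
  have hsub : VectorCalculus.divergence (fun x => u x - angVelQuot u x • rotGen x) y =
      VectorCalculus.divergence u y -
        VectorCalculus.divergence (fun x => angVelQuot u x • rotGen x) y := by
    simp only [VectorCalculus.divergence, fderiv_fun_sub (hud y) hw, ContinuousLinearMap.toLinearMap_sub,
      map_sub]
  rw [hsub, divergence_smul_apply hg hJd, hdivJ, mul_zero, zero_add, real_inner_comm, gradient,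
    InnerProductSpace.toDual_symm_apply, hzero, sub_zero]

/-- **`|b| ≤ 2|v|`** for `b = v − ΦJ` (`|ΦJ| = r|Φ| ≤ |v|`). [folklore] -/
theorem norm_sub_angVelQuot_smul_rotGen_le (hax : IsAxisymmetric u) (hu : ContDiff ℝ 2 u)
    (y : EuclideanSpace ℝ (Fin 3)) : ‖u y - angVelQuot u y • rotGen y‖ ≤ 2 * ‖u y‖ := by
  have h1 : ‖angVelQuot u y • rotGen y‖ ≤ ‖u y‖ := by
    rw [norm_smul, Real.norm_eq_abs, norm_rotGen_eq_cylRadius', mul_comm]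
    exact hax.cylRadius_mul_abs_angVelQuot_le hu y
  calc ‖u y - angVelQuot u y • rotGen y‖ ≤ ‖u y‖ + ‖angVelQuot u y • rotGen y‖ := norm_sub_le _ _
    _ ≤ ‖u y‖ + ‖u y‖ := by linarith
    _ = 2 * ‖u y‖ := by ring

/-- **`|ΦJ|⁴ = (x₀² + x₁²)² Φ⁴`** (`= (v^θ)⁴`). [folklore] -/
theorem norm_angVelQuot_smul_rotGen_pow_four (u : EuclideanSpace ℝ (Fin 3) → EuclideanSpace ℝ (Fin 3))
    (y : EuclideanSpace ℝ (Fin 3)) :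
    ‖angVelQuot u y • rotGen y‖ ^ 4 = (y 0 ^ 2 + y 1 ^ 2) ^ 2 * angVelQuot u y ^ 4 := by
  have h := norm_smul_rotGen_sq (angVelQuot u y) y
  calc ‖angVelQuot u y • rotGen y‖ ^ 4 = (‖angVelQuot u y • rotGen y‖ ^ 2) ^ 2 := by ring
    _ = (angVelQuot u y ^ 2 * (y 0 ^ 2 + y 1 ^ 2)) ^ 2 := by rw [h]
    _ = (y 0 ^ 2 + y 1 ^ 2) ^ 2 * angVelQuot u y ^ 4 := by ring

end Wei2016

end Literature.Analysis.FluidPDE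

end
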